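import Literature.NumberTheory.PAdicHodge.TateTameValueGroup
import Literature.NumberTheory.PAdicHodge.TateTameTeichmuller
import Literature.NumberTheory.PAdicHodge.TateInvariantsBase
import Literature.NumberTheory.PAdicHodge.TateAlmostEtaleMonogenic
import Mathlib.Topology.Algebra.Module.FiniteDimension
import Mathlib.FieldTheory.PrimitiveElement
import HarnessLib

/-!
# The structure of tamely ramified extensions of the cyclotomic field `K_∞ = ℚ_p(μ_{p^∞})` inside `F̄`
# (Lang ANT II §5 Prop. 12 / Serre, Local Fields IV; toward Tate's (TS1), Tate 1967 §3.2)

Notation of the tree's `PAdicHodge` files: `K₀ = PadicBase F p hp ≅ ℚ_p`, `F̄ = NormedAlgClosure F`,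
`K m = K₀(ζ_{p^m})` with uniformiser `π_m = ζ_{p^m} - 1` (`‖K m^×‖ = ‖π_m‖^ℤ`,
`exists_norm_eq_zpow_of_mem_K`), `K_∞ = TateTrace.Kinf hp = ⋃ K m`.

* `TateAlmostEtale.le_adjoin_rootOfUnity_uniformizer` (**finite level**): let `K m ⊆ M ⊆ F̄` with `M/K₀`
  finite and `p ∤ [M : K m]`. Then `M ⊆ K₀(ζ_{p^m}, ζ, α)` where `ζ ∈ M` is a root of unity of order
  `N` prime to `p` (a generator of the Teichmüller representatives of `M`), and `α ∈ M` is a uniformiser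
  of `M` with `α ^ e = ζ^i π_m`, `e` the ramification index of `M / K m` (`p ∤ e`). Proof: `e ∣ [M : K m]`
  (`ramificationIndex_dvd_finrank`), so the principal unit `ϖ^e/(ω π_m)` (`ω` the Teichmüller
  representative of the unit `ϖ^e/π_m`) has an `e`-th root `w ∈ M` (`exists_pow_eq_of_norm_sub_one_lt`),
  `α = ϖ / w`; every `x ∈ M` is `ω' α^k + x'` with `ω'^N = 1`, `‖x'‖ ≤ ‖ϖ‖ ‖x‖` (discreteness), so `M`
  lies in the closure of the finite-dimensional — hence closed (`K₀` is complete) — subspace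
  `K₀(ζ_{p^m}, ζ, α)`.
* `TateAlmostEtale.eq_adjoin_rootOfUnity_radical` (**the tame structure theorem over `K_∞`**): every
  finite extension `T` of `K_∞` inside `F̄` of degree prime to `p` is `T = K_∞(ζ, α)` with `ζ^N = 1`,
  `p ∤ N`, and `α^e ∈ K_∞(ζ)^×`, `p ∤ e` — descend a primitive element `θ` of `T` to a level `K m`
  containing the coefficients of its minimal polynomial (`[K m(θ) : K m] = [T : K_∞]`) and apply the
  finite-level statement to `M = K m(θ)`.

This is the input "tame extensions are generated by roots of unity and radicals" of the last step of
the tree's elementary proof of Tate's almost étale lemma (TS1) (`TateAlmostEtaleTamePackage`). No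
`sorry`, no definitions.

References: S. Lang, *Algebraic Number Theory*, Ch. II §5 Prop. 12 [LangANT1994]; J.-P. Serre,
*Local Fields*, Ch. II §4, Ch. IV §1–§2 [SerreLocalFields1979]; J. Tate, *p-divisible groups* §3.2 [Tate1967].
-/

noncomputable section

open Polynomial IntermediateField Module ValuativeRel Field

namespace Literature.NumberTheory.PAdicHodge

namespace TateAlmostEtale

open Literature.NumberTheory.GaloisRepresentations
open Literature.NumberTheory.GaloisRepresentations.IsNonarchimedeanLocalField
open CyclotomicTower TateTrace

variable {F : Type} [Field F] [ValuativeRel F] [TopologicalSpace F] [IsNonarchimedeanLocalField F]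
  [CharZero F] {p : ℕ} [Fact p.Prime] (hp : valuation F p < 1)

/-! ### §1 Generators of the roots of unity of order `N` in `M` -/

section RootsOfUnity

variable (M : IntermediateField (PadicBase F p hp) (NormedAlgClosure F))

/-- The `N`-th roots of unity in a subfield `M ⊆ F̄` form a cyclic group: some `ζ ∈ M`, `ζ^N = 1`, has
every `ω ∈ M` with `ω^N = 1` among its powers `ζ^k`, `k ∈ ℤ`. [cite: SerreLocalFields1979, Ch. IV §1] -/
theorem exists_rootOfUnity_generator {N : ℕ} (hN : 0 < N) :
    ∃ ζ ∈ M, ζ ^ N = 1 ∧ ∀ ω ∈ M, ω ^ N = 1 → ∃ k : ℤ, ω = ζ ^ k := by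
  haveI : NeZero N := ⟨hN.ne'⟩
  obtain ⟨g, hg⟩ := IsCyclic.exists_generator (α := rootsOfUnity N M)
  refine ⟨(((g : (↥M)ˣ) : M) : NormedAlgClosure F), ((g : (↥M)ˣ) : M).2, ?_, ?_⟩
  · have h := g.2
    rw [mem_rootsOfUnity] at h
    have h' : (((g : (↥M)ˣ) : M)) ^ N = 1 := by
      rw [← Units.val_pow_eq_pow_val, h, Units.val_one]
    have := congrArg (fun z : M => (z : NormedAlgClosure F)) h'
    simpa using this
  · intro ω hωM hωN
    have hωN' : (⟨ω, hωM⟩ : M) ^ N = 1 := by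
      apply Subtype.ext; simpa using hωN
    set ω' : rootsOfUnity N M := rootsOfUnity.mkOfPowEq ⟨ω, hωM⟩ hωN' with hω'
    obtain ⟨k, hk⟩ := (Subgroup.mem_zpowers_iff).mp (hg ω')
    refine ⟨k, ?_⟩
    have h1 : (((g ^ k : rootsOfUnity N M) : (↥M)ˣ) : M) = ((ω' : (↥M)ˣ) : M) := by rw [hk]
    rw [SubgroupClass.coe_zpow, Units.val_zpow_eq_zpow_val] at h1
    have h2 : ((ω' : (↥M)ˣ) : M) = ⟨ω, hωM⟩ := by rw [hω', rootsOfUnity.val_mkOfPowEq_coe]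
    rw [h2] at h1
    have h3 := congrArg (fun z : M => (z : NormedAlgClosure F)) h1
    simp only at h3
    rw [← h3]
    rfl

end RootsOfUnity

/-! ### §2 Finite level: `M ⊆ K₀(ζ_{p^m}, ζ, α)` -/

section FiniteLevel

omit [CharZero F] in
/-- `‖w - 1‖ < 1 ⇒ ‖w‖ = 1` (ultrametric). [folklore] -/
private theorem norm_eq_one_of_norm_sub_one_lt' {w : NormedAlgClosure F} (hw : ‖w - 1‖ < 1) : ‖w‖ = 1 := by
  have h := IsUltrametricDist.norm_add_eq_max_of_norm_ne_norm (x := (1 : NormedAlgClosure F)) (y := w - 1)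
    (by rw [norm_one]; exact hw.ne')
  rwa [add_sub_cancel, norm_one, max_eq_left hw.le] at h

variable (M : IntermediateField (PadicBase F p hp) (NormedAlgClosure F))
  [FiniteDimensional (PadicBase F p hp) M]

omit [FiniteDimensional (PadicBase F p hp) M] in
/-- **Approximation step.** Let `α ∈ M` be a uniformiser (`‖M^×‖ = ‖α‖^ℤ`, `0 < ‖α‖ < 1`), and let the
`N`-th roots of unity of `M` represent the units of `M` (`‖u - ω‖ < 1`) and be powers of `ζ ∈ L`, for an
intermediate field `L ⊆ M` containing `α`. Then every `x ∈ M` is `ℓ + x'` with `ℓ ∈ L` and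
`‖x'‖ ≤ ‖α‖ ‖x‖` (`x = u α^k`, `u = ω + u'`, `‖u'‖ ≤ ‖α‖` by discreteness).
[cite: SerreLocalFields1979, Ch. II §4 Prop. 8 and Ch. II §5] -/
theorem exists_mem_norm_sub_le_of_uniformizer {α ζ : NormedAlgClosure F} (hα0 : α ≠ 0) (hα1 : ‖α‖ < 1)
    (hval : ∀ x ∈ M, x ≠ 0 → ∃ k : ℤ, ‖x‖ = ‖α‖ ^ k) {N : ℕ}
    (hteich : ∀ u ∈ M, ‖u‖ = 1 → ∃ ω ∈ M, ω ^ N = 1 ∧ ‖u - ω‖ < 1)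
    (hgen : ∀ ω ∈ M, ω ^ N = 1 → ∃ k : ℤ, ω = ζ ^ k)
    (L : IntermediateField (PadicBase F p hp) (NormedAlgClosure F)) (hLM : L ≤ M) (hζL : ζ ∈ L)
    (hαL : α ∈ L) {x : NormedAlgClosure F} (hx : x ∈ M) :
    ∃ ℓ ∈ L, ‖x - ℓ‖ ≤ ‖α‖ * ‖x‖ := by
  by_cases hx0 : x = 0
  · exact ⟨0, zero_mem _, by rw [hx0, sub_zero, norm_zero, mul_zero]⟩
  obtain ⟨k, hk⟩ := hval x hx hx0
  set u : NormedAlgClosure F := x * α ^ (-k) with hu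
  have huM : u ∈ M := mul_mem hx (zpow_mem (hLM hαL) _)
  have hu1 : ‖u‖ = 1 := norm_mul_uniformizer_zpow_neg hα0 hk
  obtain ⟨ω, hωM, hωN, huω⟩ := hteich u huM hu1
  obtain ⟨j, hj⟩ := hgen ω hωM hωN
  have hωL : ω ∈ L := by rw [hj]; exact zpow_mem hζL j
  have hle : ‖u - ω‖ ≤ ‖α‖ :=
    norm_le_norm_uniformizer_of_norm_lt_one hp hα0 hα1 hval (sub_mem huM hωM) huω
  refine ⟨ω * α ^ k, mul_mem hωL (zpow_mem hαL k), ?_⟩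
  have hxu : x = u * α ^ k := by
    rw [hu, mul_assoc, ← zpow_add₀ hα0, neg_add_cancel, zpow_zero, mul_one]
  have : x - ω * α ^ k = (u - ω) * α ^ k := by rw [hxu]; ring
  rw [this, norm_mul, norm_zpow, ← hk]
  exact mul_le_mul_of_nonneg_right hle (norm_nonneg _)

omit [FiniteDimensional (PadicBase F p hp) M] in
/-- Iterated approximation: under the hypotheses of `exists_mem_norm_sub_le_of_uniformizer`, every
`x ∈ M` is within `‖α‖^n ‖x‖` of `L`, for every `n`. [cite: SerreLocalFields1979, Ch. II §4–§5] -/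
theorem exists_mem_norm_sub_le_pow_of_uniformizer {α ζ : NormedAlgClosure F} (hα0 : α ≠ 0) (hα1 : ‖α‖ < 1)
    (hval : ∀ x ∈ M, x ≠ 0 → ∃ k : ℤ, ‖x‖ = ‖α‖ ^ k) {N : ℕ}
    (hteich : ∀ u ∈ M, ‖u‖ = 1 → ∃ ω ∈ M, ω ^ N = 1 ∧ ‖u - ω‖ < 1)
    (hgen : ∀ ω ∈ M, ω ^ N = 1 → ∃ k : ℤ, ω = ζ ^ k)
    (L : IntermediateField (PadicBase F p hp) (NormedAlgClosure F)) (hLM : L ≤ M) (hζL : ζ ∈ L)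
    (hαL : α ∈ L) (n : ℕ) {x : NormedAlgClosure F} (hx : x ∈ M) :
    ∃ ℓ ∈ L, ‖x - ℓ‖ ≤ ‖α‖ ^ n * ‖x‖ := by
  induction n generalizing x with
  | zero => exact ⟨0, zero_mem _, by rw [sub_zero, pow_zero, one_mul]⟩
  | succ n ih =>
    obtain ⟨ℓ, hℓL, hℓ⟩ :=
      exists_mem_norm_sub_le_of_uniformizer hp M hα0 hα1 hval hteich hgen L hLM hζL hαL hx
    obtain ⟨ℓ', hℓ'L, hℓ'⟩ := ih (sub_mem hx (hLM hℓL))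
    refine ⟨ℓ + ℓ', add_mem hℓL hℓ'L, ?_⟩
    have : x - (ℓ + ℓ') = x - ℓ - ℓ' := by ring
    rw [this]
    calc ‖x - ℓ - ℓ'‖ ≤ ‖α‖ ^ n * ‖x - ℓ‖ := hℓ'
      _ ≤ ‖α‖ ^ n * (‖α‖ * ‖x‖) := by gcongr
      _ = ‖α‖ ^ (n + 1) * ‖x‖ := by ring

/-- **A finite-dimensional `K₀`-subfield of `F̄` is closed**: it is complete for the absolute value
(`K₀` is complete; Mathlib `FiniteDimensional.complete` with the normed `K₀`-space structure
`‖c • z‖ = ‖c‖ ‖z‖` of `TateAlmostEtaleMonogenic.norm_smul_layer`), and complete subsets are closed.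
[cite: SerreLocalFields1979, Ch. II §1 Prop. 1] -/
theorem isClosed_of_finiteDimensional (L : IntermediateField (PadicBase F p hp) (NormedAlgClosure F))
    [FiniteDimensional (PadicBase F p hp) L] : IsClosed (L : Set (NormedAlgClosure F)) := by
  letI : NormedSpace (PadicBase F p hp) L := ⟨fun c z => (norm_smul_layer hp L c z).le⟩
  haveI : CompleteSpace L := FiniteDimensional.complete (PadicBase F p hp) L
  have h : IsComplete (L : Set (NormedAlgClosure F)) :=
    completeSpace_coe_iff_isComplete.mp (by infer_instance)
  exact h.isClosed

/-- **Completeness step**: under the hypotheses of `exists_mem_norm_sub_le_of_uniformizer`, `M ⊆ L`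
(`M` lies in the closure of the closed subspace `L`). [cite: SerreLocalFields1979, Ch. II §5] -/
theorem le_of_uniformizer_of_teichmuller {α ζ : NormedAlgClosure F} (hα0 : α ≠ 0) (hα1 : ‖α‖ < 1)
    (hval : ∀ x ∈ M, x ≠ 0 → ∃ k : ℤ, ‖x‖ = ‖α‖ ^ k) {N : ℕ}
    (hteich : ∀ u ∈ M, ‖u‖ = 1 → ∃ ω ∈ M, ω ^ N = 1 ∧ ‖u - ω‖ < 1)
    (hgen : ∀ ω ∈ M, ω ^ N = 1 → ∃ k : ℤ, ω = ζ ^ k)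
    (L : IntermediateField (PadicBase F p hp) (NormedAlgClosure F)) (hLM : L ≤ M) (hζL : ζ ∈ L)
    (hαL : α ∈ L) : M ≤ L := by
  haveI : FiniteDimensional (PadicBase F p hp) L :=
    Module.Finite.of_injective (IntermediateField.inclusion hLM).toLinearMap
      (IntermediateField.inclusion_injective hLM)
  intro x hx
  have hclosed := isClosed_of_finiteDimensional hp L
  suffices hcl : x ∈ closure (L : Set (NormedAlgClosure F)) by
    rw [hclosed.closure_eq] at hcl; exact hcl
  rw [Metric.mem_closure_iff]
  intro ε hε
  have hαpos : 0 < ‖α‖ := norm_pos_iff.mpr hα0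
  obtain ⟨n, hn⟩ : ∃ n : ℕ, ‖α‖ ^ n * ‖x‖ < ε := by
    by_cases hx0 : ‖x‖ = 0
    · exact ⟨0, by rw [hx0, mul_zero]; exact hε⟩
    have hxpos : 0 < ‖x‖ := lt_of_le_of_ne (norm_nonneg _) (Ne.symm hx0)
    obtain ⟨n, hn⟩ := exists_pow_lt_of_lt_one (div_pos hε hxpos) hα1
    exact ⟨n, by rwa [← lt_div_iff₀ hxpos]⟩
  obtain ⟨ℓ, hℓL, hℓ⟩ :=
    exists_mem_norm_sub_le_pow_of_uniformizer hp M hα0 hα1 hval hteich hgen L hLM hζL hαL n hx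
  exact ⟨ℓ, hℓL, by rw [dist_eq_norm]; exact hℓ.trans_lt hn⟩

/-- **Tamely ramified extensions of `K m = ℚ_p(ζ_{p^m})` are generated by a root of unity and a radical
of a uniformiser (finite level).** Let `K m ⊆ M ⊆ F̄` (`m ≥ 1`) with `M / K₀` finite and
`p ∤ [M : K m]`. Then there are `N > 0` with `p ∤ N`, a root of unity `ζ ∈ M` of order dividing `N`, the
ramification index `e > 0` of `M / K m` with `p ∤ e`, and a uniformiser `α ∈ M` with
`α ^ e = ζ ^ i · π_m`, such that `M ⊆ K₀(ζ_{p^m}, ζ, α)` (hence `M = K m(ζ, α)`).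
[cite: LangANT1994, Ch. II §5 Prop. 12] [cite: SerreLocalFields1979, Ch. IV §1–§2] -/
theorem le_adjoin_rootOfUnity_uniformizer {m : ℕ} (hm : 1 ≤ m) (hKM : K hp m ≤ M)
    (hd : ¬ p ∣ finrank (K hp m) (extendScalars hKM)) :
    ∃ (N e : ℕ) (ζ α : NormedAlgClosure F), 0 < N ∧ ¬ p ∣ N ∧ 0 < e ∧ ¬ p ∣ e ∧ ζ ∈ M ∧ ζ ^ N = 1 ∧
      α ∈ M ∧ α ≠ 0 ∧ (∃ i : ℤ, α ^ e = ζ ^ i * (zeta F p m - 1)) ∧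
      M ≤ IntermediateField.adjoin (PadicBase F p hp) {zeta F p m, ζ, α} := by
  classical
  have hprime : p.Prime := Fact.out
  set K₀ := PadicBase F p hp
  set π : NormedAlgClosure F := zeta F p m - 1 with hπ
  have hπM : π ∈ M := hKM (sub_mem (zeta_mem_K hp m) (one_mem _))
  have hπpos : 0 < ‖π‖ := norm_zeta_sub_one_pos (F := F) (p := p) hm
  have hπ0 : π ≠ 0 := norm_pos_iff.mp hπpos
  have hπ1 : ‖π‖ < 1 := by
    have hq1 : ‖(p : NormedAlgClosure F)‖ < 1 := by
      rw [PadicBase.norm_natCast_closure hp]; exact PadicBase.norm_p_lt_one hp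
    have h := norm_zeta_sub_one_pow (F := F) (p := p) hm
    by_contra hge
    rw [not_lt] at hge
    have : (1 : ℝ) ≤ ‖π‖ ^ (p ^ m).totient := one_le_pow₀ hge
    rw [hπ, h] at this
    exact absurd hq1 (not_lt.mpr this)
  -- uniformiser `ϖ` and ramification index `e`
  obtain ⟨ϖ, hϖM, hϖ0, hϖ1, hval⟩ := exists_uniformizer hp M
  obtain ⟨e, he⟩ := exists_norm_eq_uniformizer_pow_of_norm_le_one hp hϖ0 hϖ1 hval hπM hπ0 hπ1.le
  have he0 : e ≠ 0 := by
    intro h; rw [h, pow_zero] at he; exact hπ1.ne he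
  haveI : FiniteDimensional K₀ (extendScalars hKM) := inferInstanceAs (FiniteDimensional K₀ M)
  haveI : FiniteDimensional (K hp m) (extendScalars hKM) :=
    Module.Finite.of_restrictScalars_finite K₀ (K hp m) (extendScalars hKM)
  have hpe : ¬ p ∣ e :=
    not_dvd_ramificationIndex_of_not_dvd_finrank hp (K hp m) (extendScalars hKM)
      (fun y hy hy0 => exists_norm_eq_zpow_of_mem_K hp hm hy hy0) (show ϖ ∈ extendScalars hKM from hϖM)
      hϖ0 hϖ1 he hd
  -- Teichmüller representatives and a generator `ζ` of the `N`-th roots of unity of `M`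
  obtain ⟨N, hN0, hpN, hteich⟩ := exists_teichmuller hp M
  obtain ⟨ζ, hζM, hζN, hgen⟩ := exists_rootOfUnity_generator hp M hN0
  -- the unit `v = ϖ^e / π`, its representative `ω`, the principal unit `v / ω` and its `e`-th root `w`
  set v : NormedAlgClosure F := ϖ ^ e * π⁻¹ with hv
  have hvM : v ∈ M := mul_mem (pow_mem hϖM e) (inv_mem hπM)
  have hv1 : ‖v‖ = 1 := by
    rw [hv, norm_mul, norm_inv, norm_pow, ← he, mul_inv_cancel₀ hπpos.ne']
  obtain ⟨ω, hωM, hωN, hvω⟩ := hteich v hvM hv1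
  have hω1 : ‖ω‖ = 1 := by
    have : ‖ω‖ ^ N = 1 := by rw [← norm_pow, hωN, norm_one]
    exact (pow_eq_one_iff_of_nonneg (norm_nonneg _) hN0.ne').mp this
  have hω0 : ω ≠ 0 := fun h => by rw [h, norm_zero] at hω1; exact zero_ne_one hω1
  set v₁ : NormedAlgClosure F := v * ω⁻¹ with hv₁
  have hv₁M : v₁ ∈ M := mul_mem hvM (inv_mem hωM)
  have hv₁1 : ‖v₁ - 1‖ < 1 := by
    have : v₁ - 1 = (v - ω) * ω⁻¹ := by rw [hv₁, sub_mul, mul_inv_cancel₀ hω0]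
    rw [this, norm_mul, norm_inv, hω1, inv_one, mul_one]; exact hvω
  obtain ⟨w, hwM, hwe, hw1⟩ := exists_pow_eq_of_norm_sub_one_lt hp M hpe he0 hv₁M hv₁1
  have hwn : ‖w‖ = 1 := norm_eq_one_of_norm_sub_one_lt' hw1
  have hw0 : w ≠ 0 := fun h => by rw [h, norm_zero] at hwn; exact zero_ne_one hwn
  -- the uniformiser `α = ϖ / w` with `α^e = ω π`
  set α : NormedAlgClosure F := ϖ * w⁻¹ with hα
  have hαM : α ∈ M := mul_mem hϖM (inv_mem hwM)
  have hαn : ‖α‖ = ‖ϖ‖ := by rw [hα, norm_mul, norm_inv, hwn, inv_one, mul_one]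
  have hα0 : α ≠ 0 := mul_ne_zero hϖ0 (inv_ne_zero hw0)
  have hαe : α ^ e = ω * π := by
    have hv0 : v ≠ 0 := fun h => by rw [h, norm_zero] at hv1; exact zero_ne_one hv1
    rw [hα, mul_pow, inv_pow, hwe, hv₁, hv]
    field_simp
  have hvalα : ∀ x ∈ M, x ≠ 0 → ∃ k : ℤ, ‖x‖ = ‖α‖ ^ k := by
    intro x hx hx0; rw [hαn]; exact hval x hx hx0
  obtain ⟨i, hi⟩ := hgen ω hωM hωN
  -- the subfield `L = K₀(ζ_{p^m}, ζ, α) ⊆ M`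
  set L : IntermediateField K₀ (NormedAlgClosure F) := IntermediateField.adjoin K₀ {zeta F p m, ζ, α}
    with hL
  have hLM : L ≤ M := by
    rw [hL, IntermediateField.adjoin_le_iff]
    intro x hx
    simp only [Set.mem_insert_iff, Set.mem_singleton_iff] at hx
    rcases hx with rfl | rfl | rfl
    · exact hKM (zeta_mem_K hp m)
    · exact hζM
    · exact hαM
  have hζL : ζ ∈ L := IntermediateField.subset_adjoin K₀ _ (by simp)
  have hαL : α ∈ L := IntermediateField.subset_adjoin K₀ _ (by simp)
  refine ⟨N, e, ζ, α, hN0, hpN, Nat.pos_of_ne_zero he0, hpe, hζM, hζN, hαM, hα0, ⟨i, ?_⟩, ?_⟩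
  · rw [hαe, hi]
  · rw [hαn] at hvalα
    exact le_of_uniformizer_of_teichmuller hp M hα0 (by rw [hαn]; exact hϖ1)
      (fun x hx hx0 => by rw [hαn]; exact hval x hx hx0) hteich hgen L hLM hζL hαL

end FiniteLevel

/-! ### §3 The tame structure theorem over `K_∞` -/

section InfiniteLevel

/-- The coefficients of a polynomial over `K_∞ = ⋃ K m` lie in a common finite level `K m`, `m ≥ 1`.
[cite: Tate1967, §3.1] -/
theorem exists_forall_coeff_mem_K (P : (Kinf hp)[X]) :
    ∃ m : ℕ, 1 ≤ m ∧ ∀ i, ((P.coeff i : Kinf hp) : NormedAlgClosure F) ∈ K hp m := by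
  classical
  have hex : ∀ i, ∃ M : ℕ, ((P.coeff i : Kinf hp) : NormedAlgClosure F) ∈ K hp M :=
    fun i => (mem_Kinf_iff hp).mp (P.coeff i).2
  choose f hf using hex
  refine ⟨max 1 (P.support.sup f), le_max_left _ _, fun i => ?_⟩
  by_cases hi : i ∈ P.support
  · exact K_mono hp ((Finset.le_sup hi).trans (le_max_right _ _)) (hf i)
  · rw [Polynomial.notMem_support_iff.mp hi]
    exact zero_mem _

/-- **The tame structure theorem for `K_∞ = ℚ_p(μ_{p^∞})` inside `F̄`.** Every finite extension
`K_∞ ⊆ T ⊆ F̄` of degree prime to `p` is generated by a root of unity of order prime to `p` and ONE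
radical: `T = K_∞(ζ, α)` with `ζ^N = 1`, `p ∤ N`, `α ≠ 0`, `α^e ∈ K_∞(ζ)` (indeed `α^e = ζ^i π_m`),
`0 < e`, `p ∤ e`. Proof: a primitive element `θ` of `T/K_∞` has its minimal polynomial defined over some
`K m`, with `[K m(θ) : K m] = [T : K_∞]` prime to `p`; apply `le_adjoin_rootOfUnity_uniformizer` to
`M = K₀(ζ_{p^m}, θ)`. [cite: LangANT1994, Ch. II §5 Prop. 12] [cite: SerreLocalFields1979, Ch. IV §1–§2]
[cite: Tate1967, §3.2] -/
theorem eq_adjoin_rootOfUnity_radical (T : IntermediateField (Kinf hp) (NormedAlgClosure F))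
    [FiniteDimensional (Kinf hp) T] (hd : ¬ p ∣ finrank (Kinf hp) T) :
    ∃ (N e : ℕ) (ζ α : NormedAlgClosure F), 0 < N ∧ ¬ p ∣ N ∧ 0 < e ∧ ¬ p ∣ e ∧ ζ ^ N = 1 ∧ α ≠ 0 ∧
      α ^ e ∈ (↥(Kinf hp))⟮ζ⟯ ∧ T = IntermediateField.adjoin (Kinf hp) {ζ, α} := by
  classical
  have hprime : p.Prime := Fact.out
  set K₀ := PadicBase F p hp
  haveI : CharZero (Kinf hp) :=
    charZero_of_injective_algebraMap (algebraMap K₀ (Kinf hp)).injective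
  haveI : Algebra.IsSeparable (Kinf hp) T := Algebra.IsAlgebraic.isSeparable_of_perfectField
  -- a primitive element `θ` and its minimal polynomial `P` over `K_∞`
  obtain ⟨θ₀, hθ₀⟩ := Field.exists_primitive_element (Kinf hp) T
  set θ : NormedAlgClosure F := (θ₀ : NormedAlgClosure F) with hθ
  have hT : T = (↥(Kinf hp))⟮θ⟯ := by
    rw [hθ, ← IntermediateField.lift_adjoin_simple, hθ₀, IntermediateField.lift_top]
  have hint : IsIntegral (Kinf hp) θ := Algebra.IsIntegral.isIntegral θ
  set P : (Kinf hp)[X] := minpoly (Kinf hp) θ with hP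
  set d : ℕ := P.natDegree with hdd
  have hdT : finrank (Kinf hp) T = d := by
    rw [(IntermediateField.equivOfEq hT).toLinearEquiv.finrank_eq, IntermediateField.adjoin.finrank hint]
  rw [hdT] at hd
  -- a level `K m` containing the coefficients of `P`; `B = K m`, `Q ∈ B[X]` with `Q = P`
  obtain ⟨m, hm, hcoef⟩ := exists_forall_coeff_mem_K hp P
  set B : IntermediateField K₀ (NormedAlgClosure F) := K hp m with hB
  have hBK : B ≤ Kinf hp := K_le_Kinf hp m
  have hlifts : P.map (algebraMap (Kinf hp) (NormedAlgClosure F)) ∈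
      Polynomial.lifts (algebraMap B (NormedAlgClosure F)) := by
    rw [lifts_iff_coeff_lifts]
    intro i
    rw [coeff_map]
    exact ⟨⟨_, hcoef i⟩, rfl⟩
  obtain ⟨Q, hQmap, hQdeg, hQmo⟩ :=
    lifts_and_natDegree_eq_and_monic hlifts ((minpoly.monic hint).map _)
  have hQdeg' : Q.natDegree = d := by rw [hQdeg, natDegree_map]
  have hQθ : aeval θ Q = 0 := by
    rw [aeval_def, ← eval_map, hQmap, eval_map, ← aeval_def, hP, minpoly.aeval]
  have hintB : IsIntegral B θ := ⟨Q, hQmo, by rwa [← aeval_def]⟩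
  -- `[B(θ) : B] = d`
  have hdegB : (minpoly B θ).natDegree = d := by
    apply le_antisymm
    · rw [← hQdeg']
      exact natDegree_le_of_dvd (minpoly.dvd B θ hQθ) hQmo.ne_zero
    · set R' : (Kinf hp)[X] := (minpoly B θ).map (IntermediateField.inclusion hBK).toRingHom with hR'
      have hR'θ : aeval θ R' = 0 := by
        rw [aeval_def, hR', eval₂_map]
        have hcomp : (algebraMap (Kinf hp) (NormedAlgClosure F)).comp
            (IntermediateField.inclusion hBK).toRingHom = algebraMap B (NormedAlgClosure F) := by
          ext x; rfl
        rw [hcomp, ← aeval_def, minpoly.aeval]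
      have hR'0 : R' ≠ 0 := by
        rw [hR']; exact (Polynomial.map_ne_zero_iff (IntermediateField.inclusion hBK).injective).mpr
          (minpoly.ne_zero hintB)
      have h := natDegree_le_of_dvd (minpoly.dvd (Kinf hp) θ hR'θ) hR'0
      rwa [hR', natDegree_map_eq_of_injective (IntermediateField.inclusion hBK).injective] at h
  -- `M₀ = K₀(ζ_{p^m}, θ) ⊇ B`, finite over `K₀`, with `[M₀ : B] = d`
  set M₀ : IntermediateField K₀ (NormedAlgClosure F) := IntermediateField.adjoin K₀ {zeta F p m, θ} with hM₀
  haveI : FiniteDimensional K₀ M₀ := by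
    rw [hM₀]
    exact IntermediateField.finiteDimensional_adjoin fun x _ => Algebra.IsIntegral.isIntegral x
  have hBM₀ : B ≤ M₀ := by
    rw [hB, K_def, hM₀]
    exact IntermediateField.adjoin.mono K₀ _ _ (by simp)
  have hθM₀ : θ ∈ M₀ := IntermediateField.subset_adjoin K₀ _ (by simp)
  have hext : extendScalars hBM₀ = (↥B)⟮θ⟯ := by
    apply IntermediateField.restrictScalars_injective K₀
    rw [IntermediateField.extendScalars_restrictScalars, IntermediateField.restrictScalars_adjoin]
    apply le_antisymm
    · rw [hM₀, IntermediateField.adjoin_le_iff]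
      intro x hx
      simp only [Set.mem_insert_iff, Set.mem_singleton_iff] at hx
      rcases hx with rfl | rfl
      · exact IntermediateField.subset_adjoin K₀ _ (Set.mem_union_left _ (zeta_mem_K hp m))
      · exact IntermediateField.subset_adjoin K₀ _ (Set.mem_union_right _ rfl)
    · rw [IntermediateField.adjoin_le_iff]
      intro x hx
      rcases hx with hx | hx
      · exact hBM₀ hx
      · rw [Set.mem_singleton_iff] at hx; rw [hx]; exact hθM₀
  have hdB : ¬ p ∣ finrank B (extendScalars hBM₀) := by
    rwa [hext, IntermediateField.adjoin.finrank hintB, hdegB]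
  -- the finite-level structure theorem
  obtain ⟨N, e, ζ, α, hN0, hpN, he0, hpe, hζM, hζN, hαM, hα0, ⟨i, hi⟩, hM₀L⟩ :=
    le_adjoin_rootOfUnity_uniformizer hp M₀ hm hBM₀ hdB
  have hπK : zeta F p m - 1 ∈ Kinf hp := sub_mem (hBK (zeta_mem_K hp m)) (one_mem _)
  refine ⟨N, e, ζ, α, hN0, hpN, he0, hpe, hζN, hα0, ?_, ?_⟩
  · rw [hi]
    refine mul_mem (zpow_mem (IntermediateField.mem_adjoin_simple_self _ ζ) i) ?_
    exact ((↥(Kinf hp))⟮ζ⟯).algebraMap_mem ⟨_, hπK⟩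
  · apply le_antisymm
    · rw [hT, IntermediateField.adjoin_simple_le_iff]
      have h1 : IntermediateField.adjoin K₀ {zeta F p m, ζ, α} ≤
          (IntermediateField.adjoin (Kinf hp) {ζ, α}).restrictScalars K₀ := by
        rw [IntermediateField.adjoin_le_iff]
        intro x hx
        simp only [Set.mem_insert_iff, Set.mem_singleton_iff] at hx
        rw [IntermediateField.coe_restrictScalars, SetLike.mem_coe]
        rcases hx with rfl | rfl | rfl
        · exact (IntermediateField.adjoin (Kinf hp) {ζ, α}).algebraMap_mem ⟨_, hBK (zeta_mem_K hp m)⟩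
        · exact IntermediateField.subset_adjoin (Kinf hp) _ (by simp)
        · exact IntermediateField.subset_adjoin (Kinf hp) _ (by simp)
      have h2 := h1 (hM₀L hθM₀)
      rwa [IntermediateField.mem_restrictScalars] at h2
    · rw [IntermediateField.adjoin_le_iff]
      have hM₀T : M₀ ≤ T.restrictScalars K₀ := by
        rw [hM₀, IntermediateField.adjoin_le_iff]
        intro x hx
        simp only [Set.mem_insert_iff, Set.mem_singleton_iff] at hx
        rw [IntermediateField.coe_restrictScalars, SetLike.mem_coe]
        rcases hx with rfl | rfl
        · exact T.algebraMap_mem ⟨_, hBK (zeta_mem_K hp m)⟩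
        · exact θ₀.2
      intro x hx
      simp only [Set.mem_insert_iff, Set.mem_singleton_iff] at hx
      rcases hx with rfl | rfl
      · have := hM₀T hζM; rwa [IntermediateField.mem_restrictScalars] at this
      · have := hM₀T hαM; rwa [IntermediateField.mem_restrictScalars] at this

end InfiniteLevel

/-! ### §4 (appended) The tame structure theorem over an arbitrary finite base `B` (Lang ANT II §5 Prop. 12) -/

section GeneralBase

variable (M : IntermediateField (PadicBase F p hp) (NormedAlgClosure F))
  [FiniteDimensional (PadicBase F p hp) M]

/-- **Tamely ramified extensions of a `p`-adic field are generated by a root of unity and one radical of a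
uniformiser (Lang, ANT II §5 Prop. 12; Serre, Local Fields IV §1–§2), inside `F̄`.** Let
`K₀ ⊆ B ⊆ M ⊆ F̄` with `M/K₀` finite, `π ∈ B` a uniformiser of `B` (`‖B^×‖ = ‖π‖^ℤ`, `0 < ‖π‖ < 1`),
`ϖ ∈ M` a uniformiser of `M`, and `‖π‖ = ‖ϖ‖^e` with `p ∤ e` (the extension is TAMELY ramified; e.g.
`p ∤ [M : B]`, `ramificationIndex_dvd_finrank`). Then there are `N > 0` with `p ∤ N`, a root of unity
`ζ ∈ M` (`ζ^N = 1`, generating the Teichmüller representatives of `M`) and a uniformiser `α ∈ M` with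
`α^e = ζ^i π`, such that `M ⊆ K₀(B, ζ, α)` (so `M = B(ζ)(α)`: unramified part `B(ζ)`, then the radical
`α = (ζ^i π)^{1/e}`). Same proof as `le_adjoin_rootOfUnity_uniformizer` (the case `B = K m`, `π = π_m`).
[cite: LangANT1994, Ch. II §5 Prop. 12] [cite: SerreLocalFields1979, Ch. IV §1–§2] -/
theorem le_adjoin_rootOfUnity_uniformizer_of_tame
    (B : IntermediateField (PadicBase F p hp) (NormedAlgClosure F)) (hBM : B ≤ M)
    {π : NormedAlgClosure F} (hπB : π ∈ B) (hπ0 : π ≠ 0)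
    {ϖ : NormedAlgClosure F} (hϖM : ϖ ∈ M) (hϖ0 : ϖ ≠ 0) (hϖ1 : ‖ϖ‖ < 1)
    (hval : ∀ x ∈ M, x ≠ 0 → ∃ k : ℤ, ‖x‖ = ‖ϖ‖ ^ k)
    {e : ℕ} (he : ‖π‖ = ‖ϖ‖ ^ e) (hpe : ¬ p ∣ e) (he0 : e ≠ 0) :
    ∃ (N : ℕ) (ζ α : NormedAlgClosure F), 0 < N ∧ ¬ p ∣ N ∧ ζ ∈ M ∧ ζ ^ N = 1 ∧
      α ∈ M ∧ α ≠ 0 ∧ ‖α‖ = ‖ϖ‖ ∧ (∃ i : ℤ, α ^ e = ζ ^ i * π) ∧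
      M ≤ IntermediateField.adjoin (PadicBase F p hp) ((B : Set (NormedAlgClosure F)) ∪ {ζ, α}) := by
  classical
  have hprime : p.Prime := Fact.out
  set K₀ := PadicBase F p hp
  have hπM : π ∈ M := hBM hπB
  have hπpos : 0 < ‖π‖ := norm_pos_iff.mpr hπ0
  -- Teichmüller representatives and a generator `ζ` of the `N`-th roots of unity of `M`
  obtain ⟨N, hN0, hpN, hteich⟩ := exists_teichmuller hp M
  obtain ⟨ζ, hζM, hζN, hgen⟩ := exists_rootOfUnity_generator hp M hN0
  -- the unit `v = ϖ^e / π`, its representative `ω`, the principal unit `v / ω` and its `e`-th root `w`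
  set v : NormedAlgClosure F := ϖ ^ e * π⁻¹ with hv
  have hvM : v ∈ M := mul_mem (pow_mem hϖM e) (inv_mem hπM)
  have hv1 : ‖v‖ = 1 := by
    rw [hv, norm_mul, norm_inv, norm_pow, ← he, mul_inv_cancel₀ hπpos.ne']
  obtain ⟨ω, hωM, hωN, hvω⟩ := hteich v hvM hv1
  have hω1 : ‖ω‖ = 1 := by
    have : ‖ω‖ ^ N = 1 := by rw [← norm_pow, hωN, norm_one]
    exact (pow_eq_one_iff_of_nonneg (norm_nonneg _) hN0.ne').mp this
  have hω0 : ω ≠ 0 := fun h => by rw [h, norm_zero] at hω1; exact zero_ne_one hω1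
  set v₁ : NormedAlgClosure F := v * ω⁻¹ with hv₁
  have hv₁M : v₁ ∈ M := mul_mem hvM (inv_mem hωM)
  have hv₁1 : ‖v₁ - 1‖ < 1 := by
    have : v₁ - 1 = (v - ω) * ω⁻¹ := by rw [hv₁, sub_mul, mul_inv_cancel₀ hω0]
    rw [this, norm_mul, norm_inv, hω1, inv_one, mul_one]; exact hvω
  obtain ⟨w, hwM, hwe, hw1⟩ := exists_pow_eq_of_norm_sub_one_lt hp M hpe he0 hv₁M hv₁1
  have hwn : ‖w‖ = 1 := norm_eq_one_of_norm_sub_one_lt' hw1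
  have hw0 : w ≠ 0 := fun h => by rw [h, norm_zero] at hwn; exact zero_ne_one hwn
  -- the uniformiser `α = ϖ / w` with `α^e = ω π`
  set α : NormedAlgClosure F := ϖ * w⁻¹ with hα
  have hαM : α ∈ M := mul_mem hϖM (inv_mem hwM)
  have hαn : ‖α‖ = ‖ϖ‖ := by rw [hα, norm_mul, norm_inv, hwn, inv_one, mul_one]
  have hα0 : α ≠ 0 := mul_ne_zero hϖ0 (inv_ne_zero hw0)
  have hαe : α ^ e = ω * π := by
    have hv0 : v ≠ 0 := fun h => by rw [h, norm_zero] at hv1; exact zero_ne_one hv1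
    rw [hα, mul_pow, inv_pow, hwe, hv₁, hv]
    field_simp
  obtain ⟨i, hi⟩ := hgen ω hωM hωN
  -- the subfield `L = K₀(B, ζ, α) ⊆ M`
  set L : IntermediateField K₀ (NormedAlgClosure F) :=
    IntermediateField.adjoin K₀ ((B : Set (NormedAlgClosure F)) ∪ {ζ, α}) with hL
  have hLM : L ≤ M := by
    rw [hL, IntermediateField.adjoin_le_iff]
    intro x hx
    rcases hx with hx | hx
    · exact hBM hx
    · simp only [Set.mem_insert_iff, Set.mem_singleton_iff] at hx
      rcases hx with rfl | rfl
      · exact hζM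
      · exact hαM
  have hζL : ζ ∈ L := IntermediateField.subset_adjoin K₀ _ (Set.mem_union_right _ (by simp))
  have hαL : α ∈ L := IntermediateField.subset_adjoin K₀ _ (Set.mem_union_right _ (by simp))
  refine ⟨N, ζ, α, hN0, hpN, hζM, hζN, hαM, hα0, hαn, ⟨i, by rw [hαe, hi]⟩, ?_⟩
  exact le_of_uniformizer_of_teichmuller hp M hα0 (by rw [hαn]; exact hϖ1)
    (fun x hx hx0 => by rw [hαn]; exact hval x hx hx0) hteich hgen L hLM hζL hαL

/-- **Prime-to-`p` extensions of a finite `B ⊇ K₀` inside `F̄` are `B(ζ)(α)`** (the form over an arbitrary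
finite base of `le_adjoin_rootOfUnity_uniformizer`): for `K₀ ⊆ B ⊆ M ⊆ F̄` with `M/K₀` finite and
`p ∤ [M : B]`, uniformisers exist (`exists_uniformizer`), the ramification index divides the degree
(`ramificationIndex_dvd_finrank`), and `le_adjoin_rootOfUnity_uniformizer_of_tame` applies.
[cite: LangANT1994, Ch. II §5 Prop. 12] [cite: SerreLocalFields1979, Ch. IV §1–§2] -/
theorem le_adjoin_rootOfUnity_uniformizer_of_not_dvd_finrank
    (B : IntermediateField (PadicBase F p hp) (NormedAlgClosure F)) (hBM : B ≤ M)
    (hd : ¬ p ∣ finrank B (extendScalars hBM)) :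
    ∃ (N e : ℕ) (π ζ α : NormedAlgClosure F), 0 < N ∧ ¬ p ∣ N ∧ 0 < e ∧ ¬ p ∣ e ∧
      π ∈ B ∧ π ≠ 0 ∧ (∀ y ∈ B, y ≠ 0 → ∃ j : ℤ, ‖y‖ = ‖π‖ ^ j) ∧ ζ ∈ M ∧ ζ ^ N = 1 ∧
      α ∈ M ∧ α ≠ 0 ∧ (∀ x ∈ M, x ≠ 0 → ∃ k : ℤ, ‖x‖ = ‖α‖ ^ k) ∧ (∃ i : ℤ, α ^ e = ζ ^ i * π) ∧
      M ≤ IntermediateField.adjoin (PadicBase F p hp) ((B : Set (NormedAlgClosure F)) ∪ {ζ, α}) := by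
  classical
  set K₀ := PadicBase F p hp
  haveI : FiniteDimensional K₀ B :=
    Module.Finite.of_injective (IntermediateField.inclusion hBM).toLinearMap
      (IntermediateField.inclusion_injective hBM)
  haveI : FiniteDimensional K₀ (extendScalars hBM) := inferInstanceAs (FiniteDimensional K₀ M)
  haveI : FiniteDimensional B (extendScalars hBM) :=
    Module.Finite.of_restrictScalars_finite K₀ B (extendScalars hBM)
  obtain ⟨π, hπB, hπ0, hπ1, hvalB⟩ := exists_uniformizer hp B
  obtain ⟨ϖ, hϖM, hϖ0, hϖ1, hval⟩ := exists_uniformizer hp M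
  obtain ⟨e, he⟩ := exists_norm_eq_uniformizer_pow_of_norm_le_one hp hϖ0 hϖ1 hval (hBM hπB) hπ0 hπ1.le
  have he0 : e ≠ 0 := by
    intro h; rw [h, pow_zero] at he; exact hπ1.ne he
  have hpe : ¬ p ∣ e :=
    not_dvd_ramificationIndex_of_not_dvd_finrank hp B (extendScalars hBM) hvalB
      (show ϖ ∈ extendScalars hBM from hϖM) hϖ0 hϖ1 he hd
  obtain ⟨N, ζ, α, hN0, hpN, hζM, hζN, hαM, hα0, hαn, hi, hle⟩ :=
    le_adjoin_rootOfUnity_uniformizer_of_tame hp M B hBM hπB hπ0 hϖM hϖ0 hϖ1 hval he hpe he0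
  exact ⟨N, e, π, ζ, α, hN0, hpN, Nat.pos_of_ne_zero he0, hpe, hπB, hπ0, hvalB, hζM, hζN, hαM, hα0,
    fun x hx hx0 => by rw [hαn]; exact hval x hx hx0, hi, hle⟩

end GeneralBase

end TateAlmostEtale

end Literature.NumberTheory.PAdicHodge

end
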